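import Literature.AlgebraicGeometry.Resolution.HasseSchmidtChartOrder
import Literature.AlgebraicGeometry.Resolution.HasseSchmidtDerivatives
import Literature.AlgebraicGeometry.Resolution.OrderAlongCurveGeneric
import Literature.AlgebraicGeometry.Resolution.ExcellentRingsFieldProofs
import Mathlib.RingTheory.Jacobson.Ring
import Mathlib.RingTheory.RegularLocalRing.Polynomial
import Mathlib.RingTheory.Spectrum.Prime.Topology
import HarnessLib

/-!
# Differential Zariski–Nagata in the polynomial model over a perfect field ⇒ (c8) for `ι = ord`

Route `ResolutionOfSingularities/WeightedInvariant`, door crux `Theses.WeightedInvariant.HypersurfaceCentreConstruction`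
(stmt-ResolutionOfSingularities-19897), door line `local-engine`, H2a‴ clause (c8) `IotaUpperSemicontinuous` for the
first `ι`-instance `ι = ord` (ORDER (o15) of `res-L1-w43-plan-1`, CRUX-PLAN §v6.8). Def-free helper lemmas
(`--supports stmt-ResolutionOfSingularities-19897`); pure commutative algebra; no statement of H. Hironaka's 2017
manuscript is typed or used and nothing here is a claim about resolution of singularities. AI-written; weaker than
expert review.

**Setting.** `k₀` a PERFECT field (any characteristic), `A = k₀[x_i : i ∈ σ]` (`σ` finite; the order's `Fin m`),
`f ∈ A`, `N ∈ ℕ`, and `𝔭 ⊂ A` ANY prime ideal — closed or not: the residue field `κ(𝔭)` is a finitely generated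
extension of `k₀`, imperfect in general. `D^{(β)} = hasseDeriv k₀ β` are the multivariate Hasse–Schmidt (divided,
Taylor) derivatives of the tree (`HasseSchmidtDerivatives.lean`: `D^{(β)} f = coeff_{u^β} f(x + u)`).

* `algebraMap_mem_maximalIdeal_pow_iff_forall_hasseDeriv_mem` — **differential Zariski–Nagata at every prime**:
  `f/1 ∈ 𝔪_{A_𝔭}^N ⟺ D^{(β)} f ∈ 𝔭 for all |β| < N`, i.e. `f ∈ 𝔭⁽ᴺ⁾` (symbolic power,
  `exists_mul_mem_pow_iff_forall_hasseDeriv_mem`) iff all Hasse–Schmidt derivatives of order `< N` of `f` vanish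
  along `V(𝔭)`;
* hence `setOf_algebraMap_mem_maximalIdeal_pow_eq_zeroLocus` / `isClosed_setOf_algebraMap_mem_maximalIdeal_pow` —
  **the super-level sets of the order are zero sets**: `{𝔭 ∈ Spec A : ord_𝔭 f ≥ N} = V(D^{(β)} f : |β| < N)` is
  CLOSED in `Spec A` — the (c8) `IotaUpperSemicontinuous` instance for `ι = ord` on affine space
  (`isClosed_setOf_le_of_forall_iff`: every `ℕ∞`-valued function `ord` on `Spec A` with
  `n ≤ ord 𝔭 ⟺ f/1 ∈ 𝔪_{A_𝔭}^n` has closed super-level sets), from which the smooth case follows étale-locally.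

**Proof.** `⇒` (any commutative base ring, any prime): localise the Taylor Hasse–Schmidt homomorphism
`f ↦ f(x + t) : A → A⟦t⟧` to `A_𝔭` (`exists_hasseSchmidt_localization`); its components send `𝔪^N` into `𝔪`
for `|β| < N` (`hsComponent_mem_maximalIdeal_of_mem_pow`) and restrict to `D^{(β)}` on `A`. `⇐` at a MAXIMAL ideal:
the tree's chart-uniform order equations `mem_pow_iff_of_hasseSchmidt` (`HasseSchmidtChartOrder.lean`; this is
where perfectness enters — the residue extension at a closed point is separable, so the localised Taylor
homomorphism admits adapted generators). `⇐` at an ARBITRARY prime `𝔭`: if `f ∈ 𝔭⁽ʲ⁾ ∖ 𝔭⁽ʲ⁺¹⁾` with `j + 1 ≤ N`, the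
order of `f` is GENERICALLY `j` along `V(𝔭)` (`exists_not_mem_forall_mul_not_mem_pow`, `OrderGenericAlongPrime.lean`:
`A` regular, `V(𝔭)` generically regular by J-2 = excellence of finitely generated `k₀`-algebras,
`Stacks07QW_field_holds`), so off some `g ∉ 𝔭` every prime `𝔮 ⊇ 𝔭` has `f ∉ 𝔮^{j+1}`; `A` is Jacobson, so there is
a MAXIMAL `𝔪 ⊇ 𝔭` avoiding `g` — but `D^{(β)} f ∈ 𝔭 ⊆ 𝔪` for `|β| ≤ j` forces `f ∈ 𝔪^{j+1}` by the closed-point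
criterion: contradiction. (Equivalently: closed points are dense in the closed set `V(D^{(β)} f : |β| < N)` and in
the order stratum, which is closed by upper semicontinuity — `DiffIdealSupportOrder.lean` runs that argument
sheaf-theoretically on smooth schemes; the present file is the explicit polynomial model the H2a‴ assembly cites.)

**WARNING — why PERFECT.** Over an IMPERFECT base the `k`-linear Hasse–Schmidt derivatives do NOT detect the order at
inseparable points: `k = 𝔽_p(t)`, `A = k[x]`, `𝔭 = (x^p − t)` (maximal, residue field `k(t^{1/p})` purely
inseparable over `k`), `f = x^p − t`: `ord_𝔭 f = 1` (`f` generates `𝔭A_𝔭`, so `f ∉ 𝔭⁽²⁾`), yet EVERY `k`-linear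
Hasse–Schmidt derivative `D^{(j)} f`, `0 ≤ j < p`, lies in `𝔭` (`D^{(0)} f = f`, `D^{(j)}(x^p) = (p choose j) x^{p−j} = 0`
for `0 < j < p`), so the criterion `⇐` FAILS for `N = 2 ≤ p`. Over the perfect field `k₀ = 𝔽_p` with `A = 𝔽_p[t, x]`
the derivative `∂_t f = −1` sees the point. This is exactly why the door lives over PERFECT fields (H2a′ binder
`[PerfectField k₀]`).

References: [EGAIV4] ÉGA IV₄ §16.8, Thm. 16.11.2, §17.6; [Matsumura1987] H. Matsumura, *Commutative Ring Theory*,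
CUP 1986, §27 (higher derivations), §30 (Jacobian criteria), §32 p. 260 (J-2); [VillamayorU2008ReesDiff]
O. Villamayor U., Rev. Mat. Iberoam. 24 (2008), §4.1, Remark 4.3; [CossartPiltant2008] V. Cossart, O. Piltant,
J. Algebra 320 (2008), proof of Prop. 4.2 (upper semicontinuity of the order); Zariski–Nagata: O. Zariski, Ann. Mat.
Pura Appl. 29 (1949); M. Nagata, *Local Rings* (1962) (38.3); D. Eisenbud, M. Hochster, J. Algebra 58 (1979).
-/

set_option linter.dupNamespace false -- mandated namespace of this single-conjunct summit

noncomputable section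

namespace Summit.ResolutionOfSingularities.ResolutionOfSingularities.Theorems

open IsLocalRing MvPolynomial Finsupp
open Literature.AlgebraicGeometry.Resolution

universe u

/-! ## The Taylor Hasse–Schmidt homomorphism of a polynomial ring -/

section Taylor

variable (K : Type u) [CommRing K] {σ : Type} [Fintype σ] [DecidableEq σ]

omit [Fintype σ] [DecidableEq σ] in
/-- The components of the Taylor Hasse–Schmidt homomorphism `f ↦ f(x + t) : K[x] → K[x]⟦t⟧` (the tree's `taylor`
followed by the inclusion of polynomials into power series) are the Hasse–Schmidt derivatives `D^{(β)}`.
[cite: EGAIV4, Thm. 16.11.2] [cite: VillamayorU2008ReesDiff, §2.6] -/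
theorem hsComponent_taylor_eq_hasseDeriv (β : σ →₀ ℕ) (f : MvPolynomial σ K) :
    hsComponent ((MvPolynomial.coeToMvPowerSeries.ringHom).comp (taylor K (σ := σ)).toRingHom) β f =
      hasseDeriv K β f := by
  rw [hsComponent, hasseDeriv_apply, RingHom.comp_apply, MvPolynomial.coeToMvPowerSeries.ringHom_apply,
    MvPolynomial.coeff_coe]
  rfl

omit [Fintype σ] [DecidableEq σ] in
/-- The Taylor Hasse–Schmidt homomorphism has constant term the identity: `f(x + 0) = f(x)` (`D^{(0)} = id`).
[cite: EGAIV4, Thm. 16.11.2 (D_0 = 1)] -/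
theorem constantCoeff_taylor_coe (f : MvPolynomial σ K) :
    MvPowerSeries.constantCoeff
        (((MvPolynomial.coeToMvPowerSeries.ringHom).comp (taylor K (σ := σ)).toRingHom) f) = f := by
  rw [← MvPowerSeries.coeff_zero_eq_constantCoeff_apply]
  change hsComponent ((MvPolynomial.coeToMvPowerSeries.ringHom).comp (taylor K (σ := σ)).toRingHom) 0 f = f
  rw [hsComponent_taylor_eq_hasseDeriv, hasseDeriv_zero_apply]

omit [Fintype σ] [DecidableEq σ] in
/-- The Taylor Hasse–Schmidt homomorphism fixes the scalars: `c ↦ c`. [cite: Matsumura1987, §27] -/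
theorem taylor_coe_algebraMap (c : K) :
    ((MvPolynomial.coeToMvPowerSeries.ringHom).comp (taylor K (σ := σ)).toRingHom)
        (algebraMap K (MvPolynomial σ K) c) =
      MvPowerSeries.C (algebraMap K (MvPolynomial σ K) c) := by
  rw [MvPolynomial.algebraMap_eq, RingHom.comp_apply, AlgHom.toRingHom_eq_coe, RingHom.coe_coe, taylor_C,
    MvPolynomial.coeToMvPowerSeries.ringHom_apply, MvPolynomial.coe_C]

omit [Fintype σ] [DecidableEq σ] in
/-- The Taylor Hasse–Schmidt homomorphism is the Taylor shift on the variables: `x_i ↦ x_i + t_i`.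
[cite: VillamayorU2008ReesDiff, §2.6 (Tay(X) = X + U)] -/
theorem taylor_coe_X (i : σ) :
    ((MvPolynomial.coeToMvPowerSeries.ringHom).comp (taylor K (σ := σ)).toRingHom)
        (algebraMap (MvPolynomial σ K) (MvPolynomial σ K) (X i)) =
      MvPowerSeries.C (algebraMap (MvPolynomial σ K) (MvPolynomial σ K) (X i)) + MvPowerSeries.X i := by
  rw [Algebra.algebraMap_self, RingHom.id_apply, RingHom.comp_apply, AlgHom.toRingHom_eq_coe, RingHom.coe_coe,
    taylor_X, MvPolynomial.coeToMvPowerSeries.ringHom_apply, MvPolynomial.coe_add, MvPolynomial.coe_C,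
    MvPolynomial.coe_X]

end Taylor

/-! ## Symbolic powers read in the localisation -/

section Symbolic

variable {A : Type*} [CommRing A]

/-- `f/1 ∈ 𝔪_{A_𝔭}^N ⟺ s·f ∈ 𝔭^N` for some `s ∉ 𝔭` (`f` lies in the `N`-th symbolic power `𝔭⁽ᴺ⁾`).
[cite: Matsumura1987, §4 (extension and contraction of ideals under localisation)] -/
theorem algebraMap_mem_maximalIdeal_pow_iff_exists_mul_mem_pow (𝔭 : Ideal A) [𝔭.IsPrime] (O : Type*)
    [CommRing O] [Algebra A O] [IsLocalization.AtPrime O 𝔭] [IsLocalRing O] (N : ℕ) (f : A) :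
    algebraMap A O f ∈ maximalIdeal O ^ N ↔ ∃ s ∉ 𝔭, s * f ∈ 𝔭 ^ N := by
  rw [← IsLocalization.AtPrime.map_eq_maximalIdeal 𝔭 O, ← Ideal.map_pow,
    IsLocalization.algebraMap_mem_map_algebraMap_iff 𝔭.primeCompl]
  exact ⟨fun ⟨s, hs, h⟩ => ⟨s, hs, h⟩, fun ⟨s, hs, h⟩ => ⟨s, hs, h⟩⟩

end Symbolic

/-! ## The differential criterion at every prime -/

section Criterion

variable (K : Type u) [Field K] {σ : Type} [Fintype σ] [DecidableEq σ]

omit [Fintype σ] [DecidableEq σ] in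
/-- **`⇒` at every prime, every base field** (indeed the argument uses no property of `K`): if `f/1 ∈ 𝔪_{A_𝔭}^N` then
`D^{(β)} f ∈ 𝔭` for all `|β| < N` — the localised Taylor Hasse–Schmidt homomorphism sends `𝔪^N` into `𝔪` in
orders `< N`. [cite: Matsumura1987, §27 (higher derivations extend to localisations)] [cite: EGAIV4, Thm. 16.11.2] -/
theorem hasseDeriv_mem_of_algebraMap_mem_maximalIdeal_pow (𝔭 : Ideal (MvPolynomial σ K)) [𝔭.IsPrime]
    (O : Type*) [CommRing O] [Algebra (MvPolynomial σ K) O] [IsLocalization.AtPrime O 𝔭] [IsLocalRing O]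
    {N : ℕ} {f : MvPolynomial σ K} (hf : algebraMap (MvPolynomial σ K) O f ∈ maximalIdeal O ^ N)
    {β : σ →₀ ℕ} (hβ : degree β < N) : hasseDeriv K β f ∈ 𝔭 := by
  set TA := (MvPolynomial.coeToMvPowerSeries.ringHom).comp (taylor K (σ := σ)).toRingHom with hTA
  letI : Algebra K O := ((algebraMap (MvPolynomial σ K) O).comp (algebraMap K (MvPolynomial σ K))).toAlgebra
  haveI : IsScalarTower K (MvPolynomial σ K) O := IsScalarTower.of_algebraMap_eq fun _ => rfl
  obtain ⟨T, hT0, -, hT⟩ := exists_hasseSchmidt_localization TA O 𝔭.primeCompl (constantCoeff_taylor_coe K)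
    (taylor_coe_algebraMap K)
  have hTcomp : ∀ (γ : σ →₀ ℕ) (a : MvPolynomial σ K),
      hsComponent T γ (algebraMap (MvPolynomial σ K) O a) = algebraMap (MvPolynomial σ K) O (hsComponent TA γ a) :=
    hsComponent_algebraMap_of_compatible TA O T hT
  obtain ⟨M, rfl⟩ : ∃ M, N = M + 1 := ⟨N - 1, by omega⟩
  have h1 := hsComponent_mem_maximalIdeal_of_mem_pow T hT0 hf (β := β) (by omega)
  rw [hTcomp, hTA, hsComponent_taylor_eq_hasseDeriv] at h1
  exact (IsLocalization.AtPrime.to_map_mem_maximal_iff O 𝔭 _).mp h1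

/-- **The order criterion at a CLOSED point of affine space over a perfect field**: for a maximal ideal `𝔪` of
`K[x_σ]`, `K` perfect, `f ∈ 𝔪^N ⟺ D^{(β)} f ∈ 𝔪` for all `|β| < N` (the tree's chart-uniform order equations
`mem_pow_iff_of_hasseSchmidt` for the identity chart; perfectness makes the residue extension separable).
[cite: EGAIV4, Thm. 16.11.2 and §17.6] [cite: VillamayorU2008ReesDiff, §4.1 and Remark 4.3] -/
theorem mem_pow_iff_forall_hasseDeriv_mem [PerfectField K] (𝔪 : Ideal (MvPolynomial σ K)) [𝔪.IsMaximal]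
    (N : ℕ) (f : MvPolynomial σ K) :
    f ∈ 𝔪 ^ N ↔ ∀ β : σ →₀ ℕ, degree β < N → hasseDeriv K β f ∈ 𝔪 := by
  have h := mem_pow_iff_of_hasseSchmidt K (A := MvPolynomial σ K)
    ((MvPolynomial.coeToMvPowerSeries.ringHom).comp (taylor K (σ := σ)).toRingHom)
    (constantCoeff_taylor_coe K) (taylor_coe_algebraMap K) (taylor_coe_X K) 𝔪 N f
  simp only [hsComponent_taylor_eq_hasseDeriv] at h
  exact h

omit [DecidableEq σ] in
/-- Finitely generated algebras over a field are J-2 (excellence, Stacks 07QW, proved in the tree): the instance for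
the polynomial ring. [cite: StacksProject, Tag 07QW] [cite: Matsumura1987, §32 p. 260] -/
theorem isJ2Ring_mvPolynomial : IsJ2Ring (MvPolynomial σ K) :=
  (isQuasiExcellentRing_of_finiteType_field K (MvPolynomial σ K)).isJ2Ring

omit [Fintype σ] [DecidableEq σ] in
/-- In the Jacobson ring `K[x_σ]` a prime is the intersection of the maximal ideals containing it: an element
outside `𝔭` is outside some maximal `𝔪 ⊇ 𝔭`. [cite: Matsumura1987, §5 (Hilbert Nullstellensatz, Thm. 5.5)] -/
theorem exists_isMaximal_le_not_mem [Finite σ] (𝔭 : Ideal (MvPolynomial σ K)) [𝔭.IsPrime]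
    {g : MvPolynomial σ K} (hg : g ∉ 𝔭) : ∃ 𝔪 : Ideal (MvPolynomial σ K), 𝔪.IsMaximal ∧ 𝔭 ≤ 𝔪 ∧ g ∉ 𝔪 := by
  have hJ : 𝔭.jacobson = 𝔭 := isJacobsonRing_iff_prime_eq.mp inferInstance 𝔭 ‹_›
  rw [← hJ, Ideal.jacobson, Submodule.mem_sInf] at hg
  push Not at hg
  obtain ⟨𝔪, ⟨h𝔭𝔪, h𝔪⟩, hg𝔪⟩ := hg
  exact ⟨𝔪, h𝔪, h𝔭𝔪, hg𝔪⟩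

/-- **`⇐` at every prime (symbolic-power form).** `K` perfect, `𝔭 ⊂ K[x_σ]` any prime: if `D^{(β)} f ∈ 𝔭` for all
`|β| < N` then `s·f ∈ 𝔭^N` for some `s ∉ 𝔭`. Induction on the symbolic order `j` of `f` along `𝔭`: if it were
`j < N`, the order of `f` would be `j` at the primes `𝔮 ⊇ 𝔭` off some `g ∉ 𝔭` (generic order along a prime in a
regular ring with `V(𝔭)` generically regular — J-2), in particular at a MAXIMAL such `𝔮 = 𝔪` (Jacobson), where the
closed-point criterion gives `f ∈ 𝔪^{j+1}` instead. [cite: CossartPiltant2008, Prop. 4.2 (proof)]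
[cite: VillamayorU2008ReesDiff, §4.1 and Remark 4.3] [cite: Matsumura1987, §32 p. 260] -/
theorem exists_mul_mem_pow_of_forall_hasseDeriv_mem [PerfectField K] (𝔭 : Ideal (MvPolynomial σ K)) [𝔭.IsPrime]
    {N : ℕ} {f : MvPolynomial σ K} (H : ∀ β : σ →₀ ℕ, degree β < N → hasseDeriv K β f ∈ 𝔭) :
    ∃ s ∉ 𝔭, s * f ∈ 𝔭 ^ N := by
  have one_not_mem : (1 : MvPolynomial σ K) ∉ 𝔭 := (Ideal.ne_top_iff_one 𝔭).mp (Ideal.IsPrime.ne_top ‹_›)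
  -- `∃ s ∉ 𝔭, s f ∈ 𝔭^j` for every `j ≤ N`, by induction on `j`
  suffices key : ∀ j, j ≤ N → ∃ s ∉ 𝔭, s * f ∈ 𝔭 ^ j from key N le_rfl
  intro j
  induction j with
  | zero => exact fun _ => ⟨1, one_not_mem, by simp⟩
  | succ j ih =>
    intro hjN
    obtain ⟨s, hs, hsf⟩ := ih (by omega)
    by_contra hno
    push Not at hno
    -- generic order `j` along `V(𝔭)` off some `g ∉ 𝔭`
    obtain ⟨g, hg, hgen⟩ := exists_not_mem_forall_mul_not_mem_pow 𝔭 ⟨s, hs, hsf⟩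
      (fun t ht h => hno t ht h) (exists_not_mem_forall_isRegularLocalRing_quotient (isJ2Ring_mvPolynomial K) 𝔭)
    -- a closed point of `V(𝔭)` avoiding `g`
    obtain ⟨𝔪, h𝔪, h𝔭𝔪, hg𝔪⟩ := exists_isMaximal_le_not_mem K 𝔭 hg
    haveI := h𝔪
    have hnot : (1 : MvPolynomial σ K) * f ∉ 𝔪 ^ (j + 1) :=
      hgen 𝔪 h𝔭𝔪 hg𝔪 1 ((Ideal.ne_top_iff_one 𝔪).mp (Ideal.IsPrime.ne_top inferInstance))
    rw [one_mul] at hnot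
    exact hnot ((mem_pow_iff_forall_hasseDeriv_mem K 𝔪 (j + 1) f).mpr fun β hβ => h𝔭𝔪 (H β (by omega)))

/-- **Differential Zariski–Nagata in the polynomial model over a perfect field** (every prime, closed or not):
for `K` perfect, `A = K[x_σ]`, `𝔭` prime, `O = A_𝔭`:
`f/1 ∈ 𝔪_O^N ⟺ ∀ β, |β| < N → D^{(β)} f ∈ 𝔭`. [cite: EGAIV4, Thm. 16.11.2 and §17.6]
[cite: VillamayorU2008ReesDiff, §4.1 and Remark 4.3] [cite: CossartPiltant2008, Prop. 4.2 (proof)] -/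
theorem algebraMap_mem_maximalIdeal_pow_iff_forall_hasseDeriv_mem [PerfectField K]
    (𝔭 : Ideal (MvPolynomial σ K)) [𝔭.IsPrime] (O : Type*) [CommRing O] [Algebra (MvPolynomial σ K) O]
    [IsLocalization.AtPrime O 𝔭] [IsLocalRing O] (N : ℕ) (f : MvPolynomial σ K) :
    algebraMap (MvPolynomial σ K) O f ∈ maximalIdeal O ^ N ↔
      ∀ β : σ →₀ ℕ, degree β < N → hasseDeriv K β f ∈ 𝔭 := by
  refine ⟨fun hf β hβ => hasseDeriv_mem_of_algebraMap_mem_maximalIdeal_pow K 𝔭 O hf hβ, fun H => ?_⟩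
  rw [algebraMap_mem_maximalIdeal_pow_iff_exists_mul_mem_pow 𝔭 O N f]
  exact exists_mul_mem_pow_of_forall_hasseDeriv_mem K 𝔭 H

/-- **Symbolic powers by derivatives**: `f ∈ 𝔭⁽ᴺ⁾` (i.e. `s·f ∈ 𝔭^N` for some `s ∉ 𝔭`) iff `D^{(β)} f ∈ 𝔭` for all
`|β| < N` (`K` perfect, `𝔭 ⊂ K[x_σ]` any prime). [cite: EGAIV4, Thm. 16.11.2 and §17.6]
[cite: VillamayorU2008ReesDiff, §4.1 and Remark 4.3] -/
theorem exists_mul_mem_pow_iff_forall_hasseDeriv_mem [PerfectField K] (𝔭 : Ideal (MvPolynomial σ K))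
    [𝔭.IsPrime] (N : ℕ) (f : MvPolynomial σ K) :
    (∃ s ∉ 𝔭, s * f ∈ 𝔭 ^ N) ↔ ∀ β : σ →₀ ℕ, degree β < N → hasseDeriv K β f ∈ 𝔭 := by
  rw [← algebraMap_mem_maximalIdeal_pow_iff_exists_mul_mem_pow 𝔭 (Localization.AtPrime 𝔭) N f]
  exact algebraMap_mem_maximalIdeal_pow_iff_forall_hasseDeriv_mem K 𝔭 (Localization.AtPrime 𝔭) N f

/-! ## The super-level sets of the order are zero sets — (c8) for `ι = ord` on affine space -/

/-- **`{𝔭 ∈ Spec K[x_σ] : ord_𝔭 f ≥ N} = V(D^{(β)} f : |β| < N)`** (`K` perfect; all primes, closed or not).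
[cite: VillamayorU2008ReesDiff, §4.1 and Remark 4.3] [cite: EGAIV4, §16.8] -/
theorem setOf_algebraMap_mem_maximalIdeal_pow_eq_zeroLocus [PerfectField K] (N : ℕ) (f : MvPolynomial σ K) :
    {𝔭 : PrimeSpectrum (MvPolynomial σ K) |
        algebraMap (MvPolynomial σ K) (Localization.AtPrime 𝔭.asIdeal) f ∈
          maximalIdeal (Localization.AtPrime 𝔭.asIdeal) ^ N} =
      PrimeSpectrum.zeroLocus ((fun β : σ →₀ ℕ => hasseDeriv K β f) '' {β | degree β < N}) := by
  ext 𝔭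
  rw [Set.mem_setOf_eq, PrimeSpectrum.mem_zeroLocus, Set.image_subset_iff,
    algebraMap_mem_maximalIdeal_pow_iff_forall_hasseDeriv_mem K 𝔭.asIdeal (Localization.AtPrime 𝔭.asIdeal) N f]
  rfl

/-- **Upper semicontinuity of the order on affine space over a perfect field** — the (c8) instance for `ι = ord`:
for every `N`, the set of primes `𝔭` of `K[x_σ]` with `f/1 ∈ 𝔪_{A_𝔭}^N` (`ord_𝔭 f ≥ N`) is closed in `Spec K[x_σ]`.
[cite: CossartPiltant2008, Prop. 4.2 (proof: upper semicontinuity of the order)]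
[cite: VillamayorU2008ReesDiff, §4.1 and Remark 4.3] -/
theorem isClosed_setOf_algebraMap_mem_maximalIdeal_pow [PerfectField K] (N : ℕ) (f : MvPolynomial σ K) :
    IsClosed {𝔭 : PrimeSpectrum (MvPolynomial σ K) |
        algebraMap (MvPolynomial σ K) (Localization.AtPrime 𝔭.asIdeal) f ∈
          maximalIdeal (Localization.AtPrime 𝔭.asIdeal) ^ N} := by
  rw [setOf_algebraMap_mem_maximalIdeal_pow_eq_zeroLocus K N f]
  exact PrimeSpectrum.isClosed_zeroLocus _

/-- **Upper semicontinuity, order-function form.** Any `ℕ∞`-valued function `ord` on `Spec K[x_σ]` (`K` perfect)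
whose super-level sets read the powers of the maximal ideals — `n ≤ ord 𝔭 ⟺ f/1 ∈ 𝔪_{A_𝔭}^n` for all `n : ℕ`, as
the `𝔪_𝔭`-adic order of `f` does — is upper semicontinuous: `{𝔭 | n ≤ ord 𝔭}` is closed for every `n : ℕ∞`
(`n = ⊤`: the intersection over all finite `n`). [cite: CossartPiltant2008, Prop. 4.2 (proof)] -/
theorem isClosed_setOf_le_of_forall_iff [PerfectField K] (f : MvPolynomial σ K)
    (ord : PrimeSpectrum (MvPolynomial σ K) → ℕ∞)
    (hord : ∀ (𝔭 : PrimeSpectrum (MvPolynomial σ K)) (n : ℕ), (n : ℕ∞) ≤ ord 𝔭 ↔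
      algebraMap (MvPolynomial σ K) (Localization.AtPrime 𝔭.asIdeal) f ∈
        maximalIdeal (Localization.AtPrime 𝔭.asIdeal) ^ n)
    (n : ℕ∞) : IsClosed {𝔭 : PrimeSpectrum (MvPolynomial σ K) | n ≤ ord 𝔭} := by
  induction n using ENat.recTopCoe with
  | top =>
    have : {𝔭 : PrimeSpectrum (MvPolynomial σ K) | (⊤ : ℕ∞) ≤ ord 𝔭} =
        ⋂ m : ℕ, {𝔭 | algebraMap (MvPolynomial σ K) (Localization.AtPrime 𝔭.asIdeal) f ∈
          maximalIdeal (Localization.AtPrime 𝔭.asIdeal) ^ m} := by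
      ext 𝔭
      simp only [Set.mem_setOf_eq, Set.mem_iInter, top_le_iff, ← hord]
      constructor
      · intro h m
        rw [h]
        exact le_top
      · intro h
        exact ENat.eq_top_iff_forall_ge.mpr h
    rw [this]
    exact isClosed_iInter fun m => isClosed_setOf_algebraMap_mem_maximalIdeal_pow K m f
  | coe m =>
    have : {𝔭 : PrimeSpectrum (MvPolynomial σ K) | (m : ℕ∞) ≤ ord 𝔭} =
        {𝔭 | algebraMap (MvPolynomial σ K) (Localization.AtPrime 𝔭.asIdeal) f ∈
          maximalIdeal (Localization.AtPrime 𝔭.asIdeal) ^ m} := by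
      ext 𝔭
      exact hord 𝔭 m
    rw [this]
    exact isClosed_setOf_algebraMap_mem_maximalIdeal_pow K m f

end Criterion

end Summit.ResolutionOfSingularities.ResolutionOfSingularities.Theorems

end
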